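import Literature.Probability.Percolation.TriTethers
import Literature.Probability.Percolation.TriTileFans
import Literature.Probability.Percolation.TriSepProbEstimates
import Literature.Probability.RandomPlanarGeometry.JordanIndexOne
import HarnessLib

/-!
# No interleaving of the boundary of the inner approximation along an arc (winding argument)

Topic `Literature/Probability/Percolation`; family `crit-perc`. The combinatorial-topological heart
of the construction of the discrete approximations `G_δ⁻` in Bollobás–Riordan, *Percolation*
(2006), Ch. 7, Lemma 14 (p. 184) and p. 191: "Let us trace the boundary of `G_δ⁻` anticlockwise.
At all times we are close to some point of `Γ` … the closest boundary arc `Γᵢ⁻` can only switch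
when we are very close to some `P_k` … the boundary arc we are close to switches only four times".
B–R argue this through the outer boundaries of sausages around the arcs and a corner analysis; here
it is replaced by a **winding-number parity argument** valid for every Jordan domain `D` and every
disc `G ⊆ δ𝕋` which is a union of tiles deep inside `D` (in particular for `innerApprox`):

* **`no_interleaving`** — let the boundary of `G` be traversed (anticlockwise, `bdryTail`), each
  boundary dart `n` carrying a tether (`Tether`, `TriTethers.lean`) from its tail to a point `qₙ` of
  `∂D`. If `A = ∂D([σa, σb])` is a boundary arc and the positions `n₁ < n₂ < n₃ < n₄ < n₁ + N` have
  `q_{n₁}, q_{n₃} ∈ A` while `q_{n₂}`, `q_{n₄}` are at distance `> 48δ` from `A`, we get a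
  contradiction. Proof: the loop `J` = (tail polyline `n₁ → n₃`) · (tether at `n₃`) · (`A` between
  `q_{n₃}` and `q_{n₁}`) · (tether at `n₁`, reversed) crosses the segment between the centres of the
  two faces on the *exit edge* of the run of the tail `u₂ = t(n₂)` exactly once (`crossInc = 2πi`,
  `crossInc_segment_side_mesh`, uniqueness of tail steps `tailStep_pair_eq`), so the winding numbers of
  `J` about the two centres differ (`crossInc_loop`); but the two centres are joined off `J`: through
  the faces of `G` (dually connected, `pathIn_triFacesIn_tileUnion`) to the exit edge of the run of
  `u₄ = t(n₄)` (not an edge of `J`), around `u₄` through faces off `G` to the midpoint of the dart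
  at `n₄`, along its tether to `q_{n₄}`, along `∂D ∖ A` to `q_{n₂}`, back along the tether at `n₂`
  and around `u₂` — so the winding numbers agree (`wind_sub_eq_of_mem_connectedComponentIn`).

Supporting lemmas: `run_window` (the run of a tail and its exit step), `not_mem_centreSeg_of_mem_tailStep`
(a centre segment of two faces of `G` meets no tail-step edge), `meshCenter_not_mem_meshEdge`.

## References

* B. Bollobás, O. Riordan, *Percolation*, Cambridge University Press (2006), Ch. 7 Lemma 14 p. 184,
  §7.2.5 pp. 190–191.

## Mathlib / tree

Mathlib: `Path.trans`, `Path.symm`, `connectedComponentIn`, `IsPreconnected.subset_connectedComponentIn`,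
`Function.Periodic.exists_mem_Ioc`. Tree: `ArgumentIncrement.lean` (`Path.crossInc`, `crossInc_trans`,
`crossInc_eq_zero`, `crossInc_loop`, `wind_sub_eq_of_mem_connectedComponentIn`), `TriTailPolyline.lean`
(`tailPoly`, `crossInc_tailPoly`, `crossInc_segment_side_mesh`, `eq_side_of_mem_segment_mesh`, `jExit`),
`TriTileBoundary.lean` (`RemovableAt.exists_run`, `tailStep_pair_eq`, `bdryTail`), `TriTethers.lean`
(`Tether`, `AvoidsMeshOf`, `dist_le_of_mem_centreSeg`), `TriTileFans.lean` (`pathIn_triFacesIn_tileUnion`),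
`JordanIndexOne.lean` (`JordanDomain.exists_int_of_boundary_eq`).
-/

noncomputable section

open Set Metric Complex Filter Topology Literature.Topology.PlaneTopology Literature.Probability.LatticeModels
  Literature.Probability.RandomPlanarGeometry

namespace Literature.Probability.Percolation

open RemovableAt (hexFaceVertices_leftFaceDir exists_offset)

/-! ### Centres versus sides -/

/-- The `j`-th barycentric coordinate vanishes on the `j`-th side. [folklore] -/
theorem cellForm_eq_zero_of_mem_triSide {F : HexVertex} {j : Fin 3} {z : ℂ}
    (hz : z ∈ segment ℝ (triEmbed (faceVertex F (j + 1))) (triEmbed (faceVertex F (j + 2)))) : cellForm F j z = 0 := by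
  obtain ⟨a, b, -, -, hab, rfl⟩ := hz
  rw [Complex.real_smul, Complex.real_smul, cellForm_lineComb F j hab, cellForm_faceVertex, cellForm_faceVertex]
  have h1 : j ≠ j + 1 := by simp
  have h2 : j ≠ j + 2 := fun h => by simpa using congrArg (· - j) h
  simp [h1, h2]

/-- The centre of a face is not on its sides. [folklore] -/
theorem hexCenter_not_mem_triSide (F : HexVertex) (j : Fin 3) :
    hexCenter F ∉ segment ℝ (triEmbed (faceVertex F (j + 1))) (triEmbed (faceVertex F (j + 2))) := fun h => by
  have := cellForm_eq_zero_of_mem_triSide h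
  rw [cellForm_hexCenter] at this
  norm_num at this

/-- The `j`-th barycentric coordinate of the centre of the face across the `j`-th side is `-1/3`.
[folklore] -/
theorem cellForm_hexCenter_oppFace (F : HexVertex) (j : Fin 3) : cellForm F j (hexCenter (oppFace F j)) = -1 / 3 := by
  have hM : cellForm F j (midpoint ℝ (hexCenter F) (hexCenter (oppFace F j))) = 0 := by
    rw [midpoint_hexCenter_oppFace]
    exact cellForm_eq_zero_of_mem_triSide (midpoint_mem_segment _ _)
  have e : midpoint ℝ (hexCenter F) (hexCenter (oppFace F j)) =
      ((2⁻¹ : ℝ) : ℂ) * hexCenter F + ((2⁻¹ : ℝ) : ℂ) * hexCenter (oppFace F j) := by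
    rw [midpoint_eq_smul_add, smul_add, Complex.real_smul, Complex.real_smul]; norm_num
  rw [e, cellForm_lineComb F j (by norm_num), cellForm_hexCenter] at hM
  linarith

/-- The centre of the face across the `j`-th side is not on that side. [folklore] -/
theorem hexCenter_oppFace_not_mem_triSide (F : HexVertex) (j : Fin 3) :
    hexCenter (oppFace F j) ∉ segment ℝ (triEmbed (faceVertex F (j + 1))) (triEmbed (faceVertex F (j + 2))) := fun h => by
  have := cellForm_eq_zero_of_mem_triSide h
  rw [cellForm_hexCenter_oppFace] at this
  norm_num at this

/-- **The scaled centre of a face lies on no closed mesh edge (and is no mesh point).** [folklore] -/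
theorem meshCenter_not_mem_meshEdge {δ : ℝ} (hδ : δ ≠ 0) (F : HexVertex) {x y : Site 2} (hxy : x = y ∨ triGraph.Adj x y) :
    meshCenter δ F ∉ segment ℝ (triMeshPoint δ x) (triMeshPoint δ y) := fun h => by
  have key : ∀ {x y : Site 2}, (x = y ∨ triGraph.Adj x y) → meshCenter δ F ∈ segment ℝ (triMeshPoint δ x) (triMeshPoint δ y) →
      x = faceVertex F (0 + 1) → y = faceVertex F (0 + 2) → False := by
    rintro x y - h rfl rfl
    rw [triMeshPoint, triMeshPoint, meshCenter, mem_segment_ofReal_mul_iff hδ, ← mul_assoc,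
      inv_mul_cancel₀ (Complex.ofReal_ne_zero.2 hδ), one_mul] at h
    exact hexCenter_not_mem_triSide F 0 h
  rcases eq_side_of_mem_segment_mesh hδ hxy h (left_mem_segment ℝ _ (meshCenter δ (oppFace F 0))) with ⟨h1, h2⟩ | ⟨h1, h2⟩
  · exact key hxy h h1 h2
  · rw [segment_symm] at h
    exact key (hxy.imp Eq.symm fun h' => h'.symm) h h2 h1

/-- **The scaled centre of the face across a side lies on no closed mesh edge.** [folklore] -/
theorem meshCenter_oppFace_not_mem_meshEdge {δ : ℝ} (hδ : δ ≠ 0) (F : HexVertex) (j : Fin 3) {x y : Site 2}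
    (hxy : x = y ∨ triGraph.Adj x y) : meshCenter δ (oppFace F j) ∉ segment ℝ (triMeshPoint δ x) (triMeshPoint δ y) :=
  meshCenter_not_mem_meshEdge hδ _ hxy

/-! ### Runs of the boundary traversal -/

/-- **The run of a tail and its exit step.** If position `n` has tail `u`, removable with outside
block `a, …, a + m - 1`, then for some `d < m` the positions `n, …, n + d` have tail `u` and position
`n + d + 1` has tail `u + e_{a+m}` (the run is left along the exit edge). [folklore] -/
theorem run_window {G : Finset (Site 2)} {b : Site 2 × Site 2} {u : Site 2} {a m : Fin 6} (hD : IsTriDisc G b)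
    (h : RemovableAt G u a m) {n : ℕ} (hn : bdryTail G b n = u) :
    ∃ d : ℕ, d < m.val ∧ (∀ e ≤ d, bdryTail G b (n + e) = u) ∧ bdryTail G b (n + d + 1) = u + triDir (a + m) := by
  set N := (triBdryDarts G).card with hN
  obtain ⟨n₀, -, hrun, hdp, -⟩ := h.exists_run hD
  obtain ⟨s, hs, hmod⟩ := h.exists_eq_of_fst_iter_eq hD hrun hn
  refine ⟨m.val - 1 - s, by omega, fun e he => ?_, ?_⟩
  · have hmod' : (n + e) % N = (n₀ + (s + e)) % N := by
      rw [Nat.add_mod, hmod, ← Nat.add_mod, add_assoc]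
    rw [← bdryTail_mod hD, hmod', bdryTail_mod hD, bdryTail, hrun (s + e) (by omega)]
    rfl
  · have hmod' : (n + (m.val - 1 - s) + 1) % N = (n₀ + m.val) % N := by
      rw [add_assoc, Nat.add_mod, hmod, ← Nat.add_mod]
      congr 1; omega
    rw [← bdryTail_mod hD, hmod', bdryTail_mod hD, bdryTail, hdp, RemovableAt.dPlus]

/-! ### Faces on an edge -/

/-- **The faces containing `u` and `u + e_K` are `leftFaceDir u K` and `leftFaceDir u (K - 1)`.** [folklore] -/
theorem eq_leftFaceDir_or_of_mem_of_mem {F : HexVertex} {u : Site 2} {K : Fin 6} (hu : u ∈ hexFaceVertices F)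
    (hK : u + triDir K ∈ hexFaceVertices F) : F = leftFaceDir u K ∨ F = leftFaceDir u (K + 5) := by
  obtain ⟨j, rfl⟩ := exists_eq_leftFaceDir_of_mem hu
  rw [hexFaceVertices_leftFaceDir] at hK
  simp only [Finset.mem_insert, Finset.mem_singleton, add_eq_left] at hK
  rcases hK with h | h | h
  · exact absurd h (triDir_ne_zero K)
  · exact Or.inl (by rw [triDir_injective (add_left_cancel h)])
  · right
    have : K = j + 1 := triDir_injective (add_left_cancel h)
    rw [this, add_assoc, show (1 : Fin 6) + 5 = 0 by decide, add_zero]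

/-- The face `leftFaceDir u (a + m - 1)` across the exit edge of a removable site is not a face of
`G`: its vertex `u + e_{a+m-1}` is outside. [folklore] -/
theorem RemovableAt.not_subset_leftFaceDir_pred {G : Finset (Site 2)} {u : Site 2} {a m : Fin 6} (h : RemovableAt G u a m) :
    ¬ hexFaceVertices (leftFaceDir u (a + m + 5)) ⊆ G := fun hsub => by
  have hout : u + triDir (a + (m + 5)) ∉ G := by
    rw [h.out_iff]
    have := h.one_le
    rw [Fin6.val_add_of_le (by simp; omega)]
    simp; omega
  refine hout (hsub ?_)
  rw [hexFaceVertices_leftFaceDir, add_assoc]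
  simp

/-- The first vertex of a side is a vertex of the face across it. [folklore] -/
theorem faceVertex_succ_mem_oppFace (F : HexVertex) (j : Fin 3) : faceVertex F (j + 1) ∈ hexFaceVertices (oppFace F j) := by
  rw [← faceVertex_oppFace_succ_succ]; exact faceVertex_mem _ _

/-- The second vertex of a side is a vertex of the face across it. [folklore] -/
theorem faceVertex_succ_succ_mem_oppFace (F : HexVertex) (j : Fin 3) : faceVertex F (j + 2) ∈ hexFaceVertices (oppFace F j) := by
  rw [← faceVertex_oppFace_succ]; exact faceVertex_mem _ _

/-- **A centre segment of two faces of a union of tiles meets no tail-step edge of its boundary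
traversal**: such an edge `{t n, t (n+1)}` borders the face `leftFaceDir (t n) (a + m - 1)`, which has
the outside vertex `t n + e_{a+m-1}`. [folklore] -/
theorem not_mem_centreSeg_of_mem_tailStep {S₀ : Finset (Site 2)} {b : Site 2 × Site 2} (hD : IsTriDisc (tileUnion S₀) b)
    {δ : ℝ} (hδ : δ ≠ 0) {F : HexVertex} {j : Fin 3} (hF : hexFaceVertices F ⊆ tileUnion S₀)
    (hF' : hexFaceVertices (oppFace F j) ⊆ tileUnion S₀) (n : ℕ) {z : ℂ}
    (hz1 : z ∈ segment ℝ (triMeshPoint δ (bdryTail (tileUnion S₀) b n)) (triMeshPoint δ (bdryTail (tileUnion S₀) b (n + 1))))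
    (hz2 : z ∈ segment ℝ (meshCenter δ F) (meshCenter δ (oppFace F j))) : False := by
  set G := tileUnion S₀ with hG
  have hab : bdryTail G b n = bdryTail G b (n + 1) ∨ triGraph.Adj (bdryTail G b n) (bdryTail G b (n + 1)) :=
    (bdryTail_succ_eq_or_adj hD n).imp Eq.symm id
  -- the step is the side `{fv (j+1), fv (j+2)}`
  have key : ∀ {x y : Site 2}, (x = faceVertex F (j + 1) ∧ y = faceVertex F (j + 2)) ∨ (x = faceVertex F (j + 2) ∧ y = faceVertex F (j + 1)) →
      (x = y → False) ∧ (x ∈ hexFaceVertices F ∧ y ∈ hexFaceVertices F ∧ x ∈ hexFaceVertices (oppFace F j) ∧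
        y ∈ hexFaceVertices (oppFace F j)) := by
    rintro x y (⟨rfl, rfl⟩ | ⟨rfl, rfl⟩)
    · refine ⟨fun h => ?_, faceVertex_mem _ _, faceVertex_mem _ _, faceVertex_succ_mem_oppFace F j, faceVertex_succ_succ_mem_oppFace F j⟩
      have := faceVertex_injective F h
      simp at this
    · refine ⟨fun h => ?_, faceVertex_mem _ _, faceVertex_mem _ _, faceVertex_succ_succ_mem_oppFace F j, faceVertex_succ_mem_oppFace F j⟩
      have := faceVertex_injective F h
      simp at this
  obtain ⟨hne, hxF, hyF, hxF', hyF'⟩ := key (eq_side_of_mem_segment_mesh hδ hab hz1 hz2)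
  set u := bdryTail G b n with hu
  -- `u` is removable; the next tail is `u + e_{a+m}`
  have huG : u ∈ G := bdryTail_mem hD n
  obtain ⟨-, hhead, hadj⟩ := mem_triBdryDarts.1 (triBdryIter_mem hD.base_mem n)
  obtain ⟨j', hj'⟩ := (triGraph_adj_iff_triDir _ _).1 hadj
  obtain ⟨a, m, hR, -⟩ := exists_removableAt_of_mem_tileUnion huG ⟨j', by rw [← bdryTail, ← hu] at hj'; exact hj' ▸ hhead⟩
  have hnext : bdryTail G b (n + 1) = u + triDir (a + m) := (hR.tailStep_neighbours hD).2.1 n hne rfl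
  rw [hnext] at hyF hyF'
  have hFne : F ≠ oppFace F j := (hexGraph_adj_oppFace F j).ne
  rcases eq_leftFaceDir_or_of_mem_of_mem hxF hyF with h1 | h1 <;>
    rcases eq_leftFaceDir_or_of_mem_of_mem hxF' hyF' with h2 | h2
  · exact hFne (h1.trans h2.symm)
  · exact hR.not_subset_leftFaceDir_pred (h2 ▸ hF')
  · exact hR.not_subset_leftFaceDir_pred (h1 ▸ hF)
  · exact hFne (h1.trans h2.symm)

end Literature.Probability.Percolation

namespace Literature.Probability.Percolation

open RemovableAt (hexFaceVertices_leftFaceDir exists_offset)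

/-! ### Fan segments at a site -/

/-- **A fan segment across an outside edge meets no tail-step edge**: the centre segment of the two
faces on the edge `{u, u + e_K}` with `u + e_K ∉ G` meets no closed mesh edge between consecutive
tails. [folklore] -/
theorem tailStep_not_mem_fanSeg {G : Finset (Site 2)} {b : Site 2 × Site 2} (hD : IsTriDisc G b) {δ : ℝ} (hδ : δ ≠ 0)
    {u : Site 2} {K : Fin 6} (hK : u + triDir K ∉ G) (n : ℕ) {z : ℂ}
    (hz1 : z ∈ segment ℝ (triMeshPoint δ (bdryTail G b n)) (triMeshPoint δ (bdryTail G b (n + 1))))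
    (hz2 : z ∈ segment ℝ (meshCenter δ (leftFaceDir u K)) (meshCenter δ (leftFaceDir u (K + 5)))) : False := by
  rw [← oppFace_leftFaceDir_jExit] at hz2
  have hab : bdryTail G b n = bdryTail G b (n + 1) ∨ triGraph.Adj (bdryTail G b n) (bdryTail G b (n + 1)) :=
    (bdryTail_succ_eq_or_adj hD n).imp Eq.symm id
  rcases eq_side_of_mem_segment_mesh hδ hab hz1 hz2 with ⟨-, h2⟩ | ⟨h1, -⟩
  · rw [faceVertex_leftFaceDir_jExit_succ_succ] at h2
    exact hK (h2 ▸ bdryTail_mem hD (n + 1))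
  · rw [faceVertex_leftFaceDir_jExit_succ_succ] at h1
    exact hK (h1 ▸ bdryTail_mem hD n)

/-- A fan segment at `u` stays within `δ` of the mesh point of `u`. [folklore] -/
theorem dist_le_of_mem_fanSeg {δ : ℝ} (hδ : 0 < δ) (u : Site 2) (K : Fin 6) {z : ℂ}
    (hz : z ∈ segment ℝ (meshCenter δ (leftFaceDir u K)) (meshCenter δ (leftFaceDir u (K + 5)))) :
    dist z (triMeshPoint δ u) ≤ δ := by
  rw [← oppFace_leftFaceDir_jExit] at hz
  refine dist_le_of_mem_centreSeg hδ hz ?_ ?_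
  · rw [hexFaceVertices_leftFaceDir]; simp
  · rw [oppFace_leftFaceDir_jExit, hexFaceVertices_leftFaceDir]; simp

/-- Scaling a midpoint by the mesh. [folklore] -/
theorem midpoint_ofReal_mul (δ : ℝ) (z w : ℂ) : midpoint ℝ ((δ : ℂ) * z) ((δ : ℂ) * w) = (δ : ℂ) * midpoint ℝ z w := by
  rw [midpoint_eq_smul_add, midpoint_eq_smul_add, smul_add, smul_add, mul_add, Complex.real_smul, Complex.real_smul,
    Complex.real_smul, Complex.real_smul]
  ring

/-- **The midpoint of the mesh edge `[u, u + e_K]` lies on the fan segment across it.** [folklore] -/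
theorem midpoint_mem_fanSeg (δ : ℝ) (u : Site 2) (K : Fin 6) :
    midpoint ℝ (triMeshPoint δ u) (triMeshPoint δ (u + triDir K)) ∈
      segment ℝ (meshCenter δ (leftFaceDir u K)) (meshCenter δ (leftFaceDir u (K + 5))) := by
  have e : midpoint ℝ (triMeshPoint δ u) (triMeshPoint δ (u + triDir K)) =
      midpoint ℝ (meshCenter δ (leftFaceDir u K)) (meshCenter δ (leftFaceDir u (K + 5))) := by
    rw [triMeshPoint, triMeshPoint, meshCenter, meshCenter, midpoint_ofReal_mul, midpoint_ofReal_mul, ← oppFace_leftFaceDir_jExit,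
      midpoint_hexCenter_oppFace, faceVertex_leftFaceDir_jExit_succ, faceVertex_leftFaceDir_jExit_succ_succ]
  rw [e]; exact midpoint_mem_segment _ _

/-- **A point avoiding the discrete structure of a disc lies on no tail-step piece** (closed mesh
edge between consecutive tails, or the mesh point of a repeated tail). [folklore] -/
theorem AvoidsMeshOf.not_mem_tailStep {S₀ : Finset (Site 2)} {b : Site 2 × Site 2} (hD : IsTriDisc (tileUnion S₀) b)
    {δ : ℝ} {z : ℂ} (hz : AvoidsMeshOf (tileUnion S₀) δ z) (n : ℕ) :
    z ∉ segment ℝ (triMeshPoint δ (bdryTail (tileUnion S₀) b n)) (triMeshPoint δ (bdryTail (tileUnion S₀) b (n + 1))) := by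
  intro h
  set G := tileUnion S₀
  rcases bdryTail_succ_eq_or_adj hD n with heq | hadj
  · -- a repeated tail: `z` is the mesh point of a site of `G`, which lies on a mesh edge of `G`
    rw [heq, segment_same, mem_singleton_iff] at h
    set g := bdryTail G b n
    have hgG : g ∈ G := bdryTail_mem hD n
    obtain ⟨-, hhead, hadj⟩ := mem_triBdryDarts.1 (triBdryIter_mem hD.base_mem n)
    obtain ⟨j', hj'⟩ := (triGraph_adj_iff_triDir _ _).1 hadj
    obtain ⟨a, m, hR, -⟩ := exists_removableAt_of_mem_tileUnion hgG ⟨j', by rw [← bdryTail] at hj'; exact hj' ▸ hhead⟩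
    have hin : g + triDir (a + 5) ∈ G := (hR.tailStep_neighbours hD).2.2.1
    exact hz.1 g hgG _ hin (triGraph_adj_add_triDir g _) (h ▸ left_mem_segment _ _ _)
  · exact hz.1 _ (bdryTail_mem hD n) _ (bdryTail_mem hD (n + 1)) hadj h

/-! ### Dual chains of faces of `G` -/

/-- **Transport along a dual chain of faces of `G`**: if every centre segment of two adjacent faces
of `G` lies in `S`, the centres of all faces of `G` chained to `F` lie in the component of the centre
of `F` in `S`. [folklore] -/
theorem meshCenter_mem_connectedComponentIn_of_pathIn {S : Set ℂ} {G : Finset (Site 2)} {δ : ℝ}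
    (hS : ∀ (F : HexVertex) (j : Fin 3), hexFaceVertices F ⊆ G → hexFaceVertices (oppFace F j) ⊆ G →
      segment ℝ (meshCenter δ F) (meshCenter δ (oppFace F j)) ⊆ S)
    {F F' : HexVertex} (hF : meshCenter δ F ∈ S) (h : PathIn hexGraph (↑(triFacesIn G) : Set HexVertex) F F') :
    meshCenter δ F' ∈ connectedComponentIn S (meshCenter δ F) := by
  obtain ⟨hF0, h⟩ := h
  induction h with
  | refl => exact mem_connectedComponentIn hF
  | @tail B C hAB hBC ih =>
    have hB : B ∈ triFacesIn G := Finset.mem_coe.1 (PathIn.right_mem (G := hexGraph) ⟨hF0, hAB⟩)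
    have hC : C ∈ triFacesIn G := Finset.mem_coe.1 hBC.2
    obtain ⟨j, rfl⟩ := exists_oppFace_eq_of_hexGraph_adj hBC.1
    rw [connectedComponentIn_eq ih]
    exact (convex_segment _ _).isPreconnected.subset_connectedComponentIn (left_mem_segment _ _ _)
      (hS B j (mem_triFacesIn.1 hB) (mem_triFacesIn.1 hC)) (right_mem_segment _ _ _)

/-! ### The boundary curve minus an arc -/

/-- **A point of the boundary curve off the arc `∂D([m, M])` lies on the complementary open arc
`∂D((M, m + 1))`.** [folklore] -/
theorem boundary_mem_image_Ioo_of_not_mem (D : JordanDomain) {m M : ℝ} {q : ℂ} (hq : q ∈ frontier D.carrier)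
    (hqA : q ∉ D.boundary '' Icc m M) : q ∈ D.boundary '' Ioo M (m + 1) := by
  rw [← D.range_boundary] at hq
  obtain ⟨x, rfl⟩ := hq
  obtain ⟨y, hy, hxy⟩ := D.periodic_boundary.exists_mem_Ioc one_pos x M
  rw [hxy]
  by_cases hym : y < m + 1
  · exact ⟨y, ⟨hy.1, hym⟩, rfl⟩
  · exfalso
    refine hqA ⟨y - 1, ⟨by linarith, by linarith [hy.2]⟩, ?_⟩
    rw [hxy, ← D.periodic_boundary.sub_eq (y)]

/-- **The complementary open arc misses the arc.** [folklore] -/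
theorem boundary_image_Ioo_disjoint (D : JordanDomain) {m M : ℝ} {z : ℂ}
    (hz : z ∈ D.boundary '' Ioo M (m + 1)) (hz' : z ∈ D.boundary '' Icc m M) : False := by
  obtain ⟨x, hx, rfl⟩ := hz
  obtain ⟨y, hy, hxy⟩ := hz'
  obtain ⟨n, hn⟩ := D.exists_int_of_boundary_eq hxy
  -- `y = x + n` with `x ∈ (M, m + 1)`, `y ∈ [m, M]`: no integer fits
  have h1 : (n : ℝ) < 0 := by linarith [hx.1, hy.2]
  have h2 : (-1 : ℝ) < n := by linarith [hx.2, hy.1]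
  have h3 : n < 0 := by exact_mod_cast h1
  have h4 : -1 < n := by exact_mod_cast h2
  omega

end Literature.Probability.Percolation

namespace Literature.Probability.Percolation

open RemovableAt (hexFaceVertices_leftFaceDir exists_offset)

/-! ### No interleaving -/

/-- Offsets in `Fin 6`: `a + ofNat (s + 1) + 5 = a + ofNat s`. [folklore] -/
theorem add_ofNat_succ_add_five (a : Fin 6) (s : ℕ) : a + Fin.ofNat 6 (s + 1) + 5 = a + Fin.ofNat 6 s := by
  rw [fin6_ofNat_succ, add_assoc a, add_assoc (Fin.ofNat 6 s), show (1 : Fin 6) + 5 = 0 by decide, add_zero]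

/-- Offsets in `Fin 6`: `a + m + 5 = a + ofNat (m - 1)` for `1 ≤ m`. [folklore] -/
theorem add_add_five_eq (a m : Fin 6) (hm : 1 ≤ m.val) : a + m + 5 = a + Fin.ofNat 6 (m.val - 1) := by
  rw [add_assoc]; congr 1
  apply Fin.ext
  rw [Fin6.val_add_of_le (by simp; omega), Fin.val_ofNat]
  simp; omega

/-- **No interleaving along an arc (Bollobás–Riordan's "the closest boundary arc switches only at the
corners", Ch. 7 p. 191, in winding form).** Let `G = tileUnion S₀` be a disc traversed from `b`, over
a connected coarse set, deep inside the Jordan domain `D` at mesh `δ` (the closed `2δ`-balls about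
its sites lie in `D`), each boundary dart `n` carrying a tether `τ n`. Let `A = ∂D([σa, σb])` be an
arc of `∂D`. Then there are no positions `n₁ ≤ n₁ + k₂ < n₁ + k₃ < n₁ + k₄ < n₁ + #∂G` such that the
tips of the tethers at `n₁` and `n₁ + k₃` lie on `A` while those at `n₁ + k₂` and `n₁ + k₄` are at
distance `> 48δ` from `A`. [cite: BollobasRiordan2006, Ch. 7 Lemma 14 p. 184, p. 191] -/
theorem no_interleaving {S₀ : Finset (Site 2)} {b : Site 2 × Site 2} (hD : IsTriDisc (tileUnion S₀) b)
    (hconn : ∀ c ∈ S₀, ∀ c' ∈ S₀, PathIn triGraph (↑S₀ : Set (Site 2)) c c')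
    (D : JordanDomain) {δ : ℝ} (hδ : 0 < δ)
    (hGU : ∀ g ∈ tileUnion S₀, closedBall (triMeshPoint δ g) (2 * δ) ⊆ D.carrier)
    (τ : ∀ n : ℕ, Tether D.carrier (tileUnion S₀) δ (bdryTail (tileUnion S₀) b n) (triBdryIter (tileUnion S₀) b n).2)
    {σa σb : ℝ} {n₁ k₂ k₃ k₄ : ℕ} (h23 : k₂ < k₃) (h34 : k₃ < k₄)
    (h4N : k₄ < (triBdryDarts (tileUnion S₀)).card)
    (h1 : (τ n₁).tip ∈ D.boundary '' Icc σa σb) (h3 : (τ (n₁ + k₃)).tip ∈ D.boundary '' Icc σa σb)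
    (hfar2 : ∀ x ∈ D.boundary '' Icc σa σb, 48 * δ < dist (τ (n₁ + k₂)).tip x)
    (hfar4 : ∀ x ∈ D.boundary '' Icc σa σb, 48 * δ < dist (τ (n₁ + k₄)).tip x) : False := by
  set N := (triBdryDarts (tileUnion S₀)).card with hN
  set A := D.boundary '' Icc σa σb with hA
  have hδ0 := hδ.ne'
  have hrem : ∀ u ∈ (tileUnion S₀), (∃ j : Fin 6, u + triDir j ∉ (tileUnion S₀)) → ∃ a m : Fin 6, RemovableAt (tileUnion S₀) u a m ∧ m.val ≤ 4 :=
    fun u hu hout => by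
      obtain ⟨a, m, h, hm⟩ := exists_removableAt_of_mem_tileUnion hu hout
      exact ⟨a, m, h, by omega⟩
  have hremt : ∀ n, ∃ a m : Fin 6, RemovableAt (tileUnion S₀) (bdryTail (tileUnion S₀) b n) a m ∧ m.val ≤ 3 := fun n => by
    obtain ⟨hx, hy, hadj⟩ := mem_triBdryDarts.1 (triBdryIter_mem hD.base_mem n)
    obtain ⟨j, hj⟩ := (triGraph_adj_iff_triDir _ _).1 hadj
    exact exists_removableAt_of_mem_tileUnion hx ⟨j, hj ▸ hy⟩
  have hhead : ∀ n, ∃ t₀ : Fin 6, (triBdryIter (tileUnion S₀) b n).2 = bdryTail (tileUnion S₀) b n + triDir t₀ ∧ bdryTail (tileUnion S₀) b n + triDir t₀ ∉ (tileUnion S₀) := fun n => by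
    obtain ⟨-, hy, hadj⟩ := mem_triBdryDarts.1 (triBdryIter_mem hD.base_mem n)
    obtain ⟨j, hj⟩ := (triGraph_adj_iff_triDir _ _).1 hadj
    exact ⟨j, hj, hj ▸ hy⟩
  -- tips versus tails
  have htip : ∀ n, dist (τ n).tip (triMeshPoint δ (bdryTail (tileUnion S₀) b n)) ≤ 12 * δ := fun n => by
    have := (τ n).dist_le 1; rwa [(τ n).path.target] at this
  have hsep : ∀ n n', 48 * δ < dist (τ n).tip (τ n').tip →
      24 * δ < dist (triMeshPoint δ (bdryTail (tileUnion S₀) b n)) (triMeshPoint δ (bdryTail (tileUnion S₀) b n')) := fun n n' h => by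
    have h1 := htip n
    have h2 := htip n'
    have := dist_triangle4 (τ n).tip (triMeshPoint δ (bdryTail (tileUnion S₀) b n)) (triMeshPoint δ (bdryTail (tileUnion S₀) b n')) (τ n').tip
    rw [dist_comm] at h2
    linarith
  have d21 : 24 * δ < dist (triMeshPoint δ (bdryTail (tileUnion S₀) b (n₁ + k₂))) (triMeshPoint δ (bdryTail (tileUnion S₀) b n₁)) := hsep _ _ (hfar2 _ h1)
  have d23 : 24 * δ < dist (triMeshPoint δ (bdryTail (tileUnion S₀) b (n₁ + k₂))) (triMeshPoint δ (bdryTail (tileUnion S₀) b (n₁ + k₃))) := hsep _ _ (hfar2 _ h3)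
  have d41 : 24 * δ < dist (triMeshPoint δ (bdryTail (tileUnion S₀) b (n₁ + k₄))) (triMeshPoint δ (bdryTail (tileUnion S₀) b n₁)) := hsep _ _ (hfar4 _ h1)
  have d43 : 24 * δ < dist (triMeshPoint δ (bdryTail (tileUnion S₀) b (n₁ + k₄))) (triMeshPoint δ (bdryTail (tileUnion S₀) b (n₁ + k₃))) := hsep _ _ (hfar4 _ h3)
  have hne21 : (bdryTail (tileUnion S₀) b (n₁ + k₂)) ≠ (bdryTail (tileUnion S₀) b n₁) := fun h => by rw [h, dist_self] at d21; linarith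
  have hne23 : (bdryTail (tileUnion S₀) b (n₁ + k₂)) ≠ (bdryTail (tileUnion S₀) b (n₁ + k₃)) := fun h => by rw [h, dist_self] at d23; linarith
  have hne41 : (bdryTail (tileUnion S₀) b (n₁ + k₄)) ≠ (bdryTail (tileUnion S₀) b n₁) := fun h => by rw [h, dist_self] at d41; linarith
  have hne43 : (bdryTail (tileUnion S₀) b (n₁ + k₄)) ≠ (bdryTail (tileUnion S₀) b (n₁ + k₃)) := fun h => by rw [h, dist_self] at d43; linarith
  have hu₁G : (bdryTail (tileUnion S₀) b n₁) ∈ (tileUnion S₀) := bdryTail_mem hD _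
  have hu₂G : (bdryTail (tileUnion S₀) b (n₁ + k₂)) ∈ (tileUnion S₀) := bdryTail_mem hD _
  have hu₄G : (bdryTail (tileUnion S₀) b (n₁ + k₄)) ∈ (tileUnion S₀) := bdryTail_mem hD _
  ---------------------------------------------------------------------------------------------
  -- the run of `(bdryTail (tileUnion S₀) b (n₁ + k₂))` and its exit edge `e = {(bdryTail (tileUnion S₀) b (n₁ + k₂)), g₂}`, at offset `i₀ < k₃`
  ---------------------------------------------------------------------------------------------
  obtain ⟨a₂, m₂, hR₂, hm₂⟩ := hremt (n₁ + k₂)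
  obtain ⟨d₂, hd₂, hrun₂, hexit₂⟩ := run_window hD hR₂ (rfl : bdryTail (tileUnion S₀) b (n₁ + k₂) = (bdryTail (tileUnion S₀) b (n₁ + k₂)))
  have hi₀ : k₂ + d₂ < k₃ := by
    by_contra h
    have := hrun₂ (k₃ - k₂) (by omega)
    rw [show n₁ + k₂ + (k₃ - k₂) = n₁ + k₃ by omega] at this
    exact hne23 this.symm
  set i₀ := k₂ + d₂ with hi₀def
  have ht_i₀ : bdryTail (tileUnion S₀) b (n₁ + i₀) = (bdryTail (tileUnion S₀) b (n₁ + k₂)) := by rw [hi₀def, ← add_assoc]; exact hrun₂ d₂ le_rfl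
  have ht_i₀' : bdryTail (tileUnion S₀) b (n₁ + i₀ + 1) = (bdryTail (tileUnion S₀) b (n₁ + k₂)) + triDir (a₂ + m₂) := by rw [hi₀def, ← add_assoc]; exact hexit₂
  set K₂ := a₂ + m₂ with hK₂
  set g₂ := (bdryTail (tileUnion S₀) b (n₁ + k₂)) + triDir K₂ with hg₂
  have hg₂ne : (bdryTail (tileUnion S₀) b (n₁ + k₂)) ≠ g₂ := fun h => triDir_ne_zero K₂ (by rw [hg₂] at h; exact (add_eq_left.1 h.symm))
  set Fe := leftFaceDir (bdryTail (tileUnion S₀) b (n₁ + k₂)) K₂ with hFe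
  set j₂ := jExit K₂ with hj₂
  set ℓ := meshCenter δ Fe with hℓ
  set r := meshCenter δ (oppFace Fe j₂) with hr
  have hFopp : oppFace Fe j₂ = leftFaceDir (bdryTail (tileUnion S₀) b (n₁ + k₂)) (K₂ + 5) := oppFace_leftFaceDir_jExit (bdryTail (tileUnion S₀) b (n₁ + k₂)) K₂
  have hfv1 : faceVertex Fe (j₂ + 1) = (bdryTail (tileUnion S₀) b (n₁ + k₂)) := faceVertex_leftFaceDir_jExit_succ (bdryTail (tileUnion S₀) b (n₁ + k₂)) K₂
  have hfv2 : faceVertex Fe (j₂ + 2) = g₂ := faceVertex_leftFaceDir_jExit_succ_succ (bdryTail (tileUnion S₀) b (n₁ + k₂)) K₂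
  have hg₂G : g₂ ∈ (tileUnion S₀) := hR₂.inside le_rfl
  have hFeG : hexFaceVertices Fe ⊆ (tileUnion S₀) := by
    rw [hFe, hexFaceVertices_leftFaceDir]
    intro x hx
    simp only [Finset.mem_insert, Finset.mem_singleton] at hx
    rcases hx with rfl | rfl | rfl
    · exact hu₂G
    · exact hg₂G
    · rw [hK₂, add_assoc]
      refine hR₂.inside ?_
      rw [Fin6.val_add_of_lt (by simp; omega)]; simp
  have hℓr_near : ∀ z ∈ segment ℝ ℓ r, dist z (triMeshPoint δ (bdryTail (tileUnion S₀) b (n₁ + k₂))) ≤ δ := fun z hz => by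
    rw [hr, hFopp] at hz
    exact dist_le_of_mem_fanSeg hδ (bdryTail (tileUnion S₀) b (n₁ + k₂)) K₂ hz
  have hℓr_U : segment ℝ ℓ r ⊆ D.carrier := fun z hz =>
    hGU (bdryTail (tileUnion S₀) b (n₁ + k₂)) hu₂G (mem_closedBall.2 (by linarith [hℓr_near z hz]))
  ---------------------------------------------------------------------------------------------
  -- the loop `J`
  ---------------------------------------------------------------------------------------------
  obtain ⟨σ₁, hσ₁, hq₁⟩ := h1
  obtain ⟨σ₃, hσ₃, hq₃⟩ := h3
  -- the tail polyline, with endpoints written as mesh points of tails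
  obtain ⟨κ, hκr, hκc⟩ : ∃ κ : Path (triMeshPoint δ (bdryTail (tileUnion S₀) b n₁)) (triMeshPoint δ (bdryTail (tileUnion S₀) b (n₁ + k₃))),
      range κ = range (tailPoly δ (tileUnion S₀) b n₁ k₃) ∧
        ∀ x y : ℂ, κ.crossInc x y = (tailPoly δ (tileUnion S₀) b n₁ k₃).crossInc x y :=
    ⟨tailPoly δ (tileUnion S₀) b n₁ k₃, rfl, fun _ _ => rfl⟩
  set τ₁ := (τ n₁).path with hτ₁
  set τ₃ := (τ (n₁ + k₃)).path with hτ₃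
  let αPath : Path (τ (n₁ + k₃)).tip (τ n₁).tip :=
    { toFun := fun s => D.boundary (σ₃ + (s : ℝ) * (σ₁ - σ₃))
      continuous_toFun := D.continuous_boundary.comp (by fun_prop)
      source' := by simp [hq₃]
      target' := by simp [hq₁] }
  have hαap : ∀ s, αPath s = D.boundary (σ₃ + (s : ℝ) * (σ₁ - σ₃)) := fun s => rfl
  set α := D.boundary '' Icc (min σ₁ σ₃) (max σ₁ σ₃) with hα
  have hα_range : ∀ s, αPath s ∈ α := fun s => by
    refine ⟨σ₃ + (s : ℝ) * (σ₁ - σ₃), ?_, (hαap s).symm⟩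
    rcases le_total σ₁ σ₃ with h | h
    · rw [min_eq_left h, max_eq_right h]
      constructor <;> nlinarith [s.2.1, s.2.2]
    · rw [min_eq_right h, max_eq_left h]
      constructor <;> nlinarith [s.2.1, s.2.2]
  have hαA : α ⊆ A := image_mono (Icc_subset_Icc (le_min hσ₁.1 hσ₃.1) (max_le hσ₁.2 hσ₃.2))
  have hq₁α : (τ n₁).tip ∈ α := ⟨σ₁, ⟨min_le_left _ _, le_max_left _ _⟩, hq₁⟩
  have hq₃α : (τ (n₁ + k₃)).tip ∈ α := ⟨σ₃, ⟨min_le_right _ _, le_max_right _ _⟩, hq₃⟩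
  set J := κ.trans (τ₃.trans (αPath.trans τ₁.symm)) with hJ
  have hJrange : range J = range κ ∪ (range τ₃ ∪ (range αPath ∪ range τ₁)) := by
    rw [hJ, Path.trans_range, Path.trans_range, Path.trans_range, Path.symm_range]
  -- criteria for being off the pieces of `J`
  have hκ_off' : ∀ z, z ≠ triMeshPoint δ (bdryTail (tileUnion S₀) b n₁) →
      (∀ i < k₃, z ∉ segment ℝ (triMeshPoint δ (bdryTail (tileUnion S₀) b (n₁ + i))) (triMeshPoint δ (bdryTail (tileUnion S₀) b (n₁ + i + 1)))) →
      z ∉ range κ := fun z h0 hz => by rw [hκr]; exact not_mem_range_tailPoly δ (tileUnion S₀) b h0 hz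
  have hκ_off : ∀ z, (∀ n, z ∉ segment ℝ (triMeshPoint δ (bdryTail (tileUnion S₀) b n)) (triMeshPoint δ (bdryTail (tileUnion S₀) b (n + 1)))) →
      z ∉ range κ := fun z hz =>
    hκ_off' z (fun h => hz n₁ (h ▸ left_mem_segment _ _ _)) fun i _ => hz (n₁ + i)
  have hτ_off : ∀ n z, 12 * δ < dist z (triMeshPoint δ (bdryTail (tileUnion S₀) b n)) → z ∉ range (τ n).path := by
    rintro n z hz ⟨s, rfl⟩
    exact absurd ((τ n).dist_le s) (not_le.2 hz)
  have hnotU_of_frontier : ∀ z ∈ frontier D.carrier, z ∉ D.carrier := fun z hz => by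
    rw [D.isOpen.frontier_eq] at hz; exact hz.2
  have hα_off : ∀ z ∈ D.carrier, z ∉ range αPath := by
    rintro z hz ⟨s, rfl⟩
    exact hnotU_of_frontier _ (D.boundary_mem_frontier _) hz
  have hJ_off : ∀ z, z ∉ range κ → z ∉ range τ₃ → z ∉ range αPath → z ∉ range τ₁ → z ∉ range J := by
    intro z h1 h2 h3 h4
    rw [hJrange]
    simp only [mem_union, not_or]
    exact ⟨h1, h2, h3, h4⟩
  have near_off : ∀ {v : Site 2}, 24 * δ < dist (triMeshPoint δ v) (triMeshPoint δ (bdryTail (tileUnion S₀) b n₁)) →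
      24 * δ < dist (triMeshPoint δ v) (triMeshPoint δ (bdryTail (tileUnion S₀) b (n₁ + k₃))) → ∀ z, dist z (triMeshPoint δ v) ≤ 12 * δ →
      z ∉ range τ₃ ∧ z ∉ range τ₁ := fun {v} hv1 hv3 z hz =>
    ⟨hτ_off (n₁ + k₃) z (by linarith [dist_triangle (triMeshPoint δ v) z (triMeshPoint δ (bdryTail (tileUnion S₀) b (n₁ + k₃))), dist_comm z (triMeshPoint δ v)]),
      hτ_off n₁ z (by linarith [dist_triangle (triMeshPoint δ v) z (triMeshPoint δ (bdryTail (tileUnion S₀) b n₁)), dist_comm z (triMeshPoint δ v)])⟩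
  -- the tail-step pieces lie in `D`
  have hκU : ∀ n z, z ∈ segment ℝ (triMeshPoint δ (bdryTail (tileUnion S₀) b n)) (triMeshPoint δ (bdryTail (tileUnion S₀) b (n + 1))) → z ∈ D.carrier := by
    intro n z hz
    refine hGU _ (bdryTail_mem hD n) (mem_closedBall.2 ?_)
    refine dist_le_of_mem_segment (by rw [dist_self]; positivity) ?_ hz
    rcases bdryTail_succ_eq_or_adj hD n with h | h
    · rw [h, dist_self]; positivity
    · rw [dist_comm, dist_triMeshPoint_eq_of_adj hδ.le h]; linarith
  ---------------------------------------------------------------------------------------------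
  -- `ℓ`, `r` are off `J`, and `J` crosses `[ℓ, r]` once: `crossInc J ℓ r = 2πi`
  ---------------------------------------------------------------------------------------------
  have hℓ_step : ∀ n, ℓ ∉ segment ℝ (triMeshPoint δ (bdryTail (tileUnion S₀) b n)) (triMeshPoint δ (bdryTail (tileUnion S₀) b (n + 1))) := fun n =>
    meshCenter_not_mem_meshEdge hδ0 Fe ((bdryTail_succ_eq_or_adj hD n).imp Eq.symm id)
  have hr_step : ∀ n, r ∉ segment ℝ (triMeshPoint δ (bdryTail (tileUnion S₀) b n)) (triMeshPoint δ (bdryTail (tileUnion S₀) b (n + 1))) := fun n =>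
    meshCenter_oppFace_not_mem_meshEdge hδ0 Fe j₂ ((bdryTail_succ_eq_or_adj hD n).imp Eq.symm id)
  have hℓ_seg : ℓ ∈ segment ℝ ℓ r := left_mem_segment _ _ _
  have hr_seg : r ∈ segment ℝ ℓ r := right_mem_segment _ _ _
  have hoffτ_of_seg : ∀ z ∈ segment ℝ ℓ r, z ∉ range τ₃ ∧ z ∉ range τ₁ := fun z hz =>
    near_off d21 d23 z (by linarith [hℓr_near z hz])
  have hℓκ := hκ_off ℓ hℓ_step
  have hrκ := hκ_off r hr_step
  have hℓ3 := (hoffτ_of_seg ℓ hℓ_seg).1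
  have hℓ1 := (hoffτ_of_seg ℓ hℓ_seg).2
  have hr3 := (hoffτ_of_seg r hr_seg).1
  have hr1 := (hoffτ_of_seg r hr_seg).2
  have hℓα := hα_off ℓ (hℓr_U hℓ_seg)
  have hrα := hα_off r (hℓr_U hr_seg)
  have hℓJ : ℓ ∉ range J := hJ_off ℓ hℓκ hℓ3 hℓα hℓ1
  have hrJ : r ∉ range J := hJ_off r hrκ hr3 hrα hr1
  have hcross : J.crossInc ℓ r = 2 * Real.pi * I := by
    -- the pieces other than `κ` miss `[ℓ, r]`
    have hτ₃0 : τ₃.crossInc ℓ r = 0 :=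
      Path.crossInc_eq_zero _ fun s hs => (hoffτ_of_seg _ hs).1 ⟨s, rfl⟩
    have hα0 : αPath.crossInc ℓ r = 0 :=
      Path.crossInc_eq_zero _ fun s hs => hα_off _ (hℓr_U hs) ⟨s, rfl⟩
    have hτ₁0 : τ₁.symm.crossInc ℓ r = 0 :=
      Path.crossInc_eq_zero _ fun s hs => (hoffτ_of_seg _ hs).2 ⟨unitInterval.symm s, rfl⟩
    -- the tail polyline crosses once, at the exit piece `i₀`
    have hκ1 : κ.crossInc ℓ r = 2 * Real.pi * I := by
      rw [hκc, crossInc_tailPoly δ (tileUnion S₀) b (fun h => hℓ_step n₁ (by rw [h]; exact left_mem_segment _ _ _))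
        (fun h => hr_step n₁ (by rw [h]; exact left_mem_segment _ _ _)) (fun i _ => hℓ_step (n₁ + i)) (fun i _ => hr_step (n₁ + i)),
        Finset.sum_eq_single i₀]
      · have e1 : tailPt δ (tileUnion S₀) b (n₁ + i₀) = triMeshPoint δ (faceVertex Fe (j₂ + 1)) := by rw [hfv1, ← ht_i₀]; rfl
        have e2 : tailPt δ (tileUnion S₀) b (n₁ + i₀ + 1) = triMeshPoint δ (faceVertex Fe (j₂ + 2)) := by rw [hfv2, ← ht_i₀']; rfl
        rw [e1, e2]
        exact crossInc_segment_side_mesh hδ Fe j₂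
      · intro i hi hne
        refine Path.crossInc_eq_zero _ fun s hs => ?_
        have hz1 : (Path.segment (tailPt δ (tileUnion S₀) b (n₁ + i)) (tailPt δ (tileUnion S₀) b (n₁ + i + 1))) s ∈
            segment ℝ (triMeshPoint δ (bdryTail (tileUnion S₀) b (n₁ + i))) (triMeshPoint δ (bdryTail (tileUnion S₀) b (n₁ + i + 1))) := by
          rw [← Path.range_segment]; exact mem_range_self s
        have hab := (bdryTail_succ_eq_or_adj hD (n₁ + i)).imp Eq.symm id
        have key : bdryTail (tileUnion S₀) b (n₁ + i) ≠ bdryTail (tileUnion S₀) b (n₁ + i + 1) ∧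
            s(bdryTail (tileUnion S₀) b (n₁ + i), bdryTail (tileUnion S₀) b (n₁ + i + 1)) = s(bdryTail (tileUnion S₀) b (n₁ + i₀), bdryTail (tileUnion S₀) b (n₁ + i₀ + 1)) := by
          rw [ht_i₀, ht_i₀']
          rcases eq_side_of_mem_segment_mesh hδ0 hab hz1 hs with ⟨h1, h2⟩ | ⟨h1, h2⟩ <;> rw [hfv1] at * <;> rw [hfv2] at * <;>
            rw [h1, h2]
          · exact ⟨hg₂ne, rfl⟩
          · exact ⟨hg₂ne.symm, Sym2.eq_swap⟩
        have hne₀ : bdryTail (tileUnion S₀) b (n₁ + i₀) ≠ bdryTail (tileUnion S₀) b (n₁ + i₀ + 1) := by rw [ht_i₀, ht_i₀']; exact hg₂ne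
        have hmod := tailStep_pair_eq hD hrem key.1 hne₀ key.2
        have hmod' : i % N = i₀ % N := Nat.ModEq.add_left_cancel' n₁ hmod
        have hik : i < k₃ := Finset.mem_range.1 hi
        rw [Nat.mod_eq_of_lt (by omega), Nat.mod_eq_of_lt (by omega)] at hmod'
        exact hne hmod'
      · intro h; exact absurd (Finset.mem_range.2 hi₀) h
    have hℓrest : ℓ ∉ range (τ₃.trans (αPath.trans τ₁.symm)) := by
      rw [Path.trans_range, Path.trans_range, Path.symm_range]; simp [hℓ3, hℓα, hℓ1]
    have hrrest : r ∉ range (τ₃.trans (αPath.trans τ₁.symm)) := by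
      rw [Path.trans_range, Path.trans_range, Path.symm_range]; simp [hr3, hrα, hr1]
    have hℓrest' : ℓ ∉ range (αPath.trans τ₁.symm) := by rw [Path.trans_range, Path.symm_range]; simp [hℓα, hℓ1]
    have hrrest' : r ∉ range (αPath.trans τ₁.symm) := by rw [Path.trans_range, Path.symm_range]; simp [hrα, hr1]
    have hℓ1' : ℓ ∉ range τ₁.symm := by rw [Path.symm_range]; exact hℓ1
    have hr1' : r ∉ range τ₁.symm := by rw [Path.symm_range]; exact hr1
    rw [hJ, Path.crossInc_trans _ _ hℓκ hℓrest hrκ hrrest, Path.crossInc_trans _ _ hℓ3 hℓrest' hr3 hrrest',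
      Path.crossInc_trans _ _ hℓα hℓ1' hrα hr1', hκ1, hτ₃0, hα0, hτ₁0]
    ring
  have hwind_ne : wind (fun s => J.extend s - ℓ) ≠ wind (fun s => J.extend s - r) := by
    intro h
    have := Path.crossInc_loop J hℓJ hrJ
    rw [hcross, h, sub_self, zero_mul] at this
    exact two_pi_I_ne_zero this
  ---------------------------------------------------------------------------------------------
  -- … but `ℓ` and `r` are joined off `J`
  ---------------------------------------------------------------------------------------------
  set S := (range J)ᶜ with hS
  have join : ∀ {x y : ℂ} {C : Set ℂ}, IsPreconnected C → C ⊆ S → x ∈ C → y ∈ C →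
      x ∈ connectedComponentIn S ℓ → y ∈ connectedComponentIn S ℓ := fun hC hCS hx hy hxℓ => by
    rw [connectedComponentIn_eq hxℓ]; exact hC.subset_connectedComponentIn hx hCS hy
  have hℓS : ℓ ∈ connectedComponentIn S ℓ := mem_connectedComponentIn hℓJ
  -- (i) centre segments of faces of `(tileUnion S₀)` lie off `J`
  have hGseg : ∀ (F : HexVertex) (j : Fin 3), hexFaceVertices F ⊆ (tileUnion S₀) → hexFaceVertices (oppFace F j) ⊆ (tileUnion S₀) →
      segment ℝ (meshCenter δ F) (meshCenter δ (oppFace F j)) ⊆ S := by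
    intro F j hF hF' z hz
    have hzU : z ∈ D.carrier := hGU _ (hF (faceVertex_mem F (j + 1)))
      (mem_closedBall.2 (by linarith [dist_le_of_mem_centreSeg hδ hz (faceVertex_mem F (j + 1)) (faceVertex_succ_mem_oppFace F j)]))
    have hτgen : ∀ n, z ∉ range (τ n).path := by
      rintro n ⟨s, hs⟩
      rw [← hs] at hz
      rcases le_total (τ n).anchor s with hle | hle
      · exact ((τ n).avoids s hle).2 F j hF hF' hz
      · have hmem := (τ n).before_anchor s hle
        obtain ⟨-, hw, hadj⟩ := mem_triBdryDarts.1 (triBdryIter_mem hD.base_mem n)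
        rcases eq_side_of_mem_segment_mesh hδ0 (Or.inr hadj) hmem hz with ⟨-, h2⟩ | ⟨-, h2⟩
        · exact hw (hF (h2 ▸ faceVertex_mem F _))
        · exact hw (hF (h2 ▸ faceVertex_mem F _))
    exact hJ_off z (hκ_off z fun n hz1 => not_mem_centreSeg_of_mem_tailStep hD hδ0 hF hF' n hz1 hz) (hτgen _) (hα_off z hzU) (hτgen _)
  have hGface : ∀ F', PathIn hexGraph (↑(triFacesIn (tileUnion S₀)) : Set HexVertex) Fe F' → meshCenter δ F' ∈ connectedComponentIn S ℓ :=
    fun F' h => meshCenter_mem_connectedComponentIn_of_pathIn hGseg hℓJ h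
  -- (ii) fans at a far site: the fan segments across outside edges lie off `J`
  have hfan : ∀ {u : Site 2} {a m : Fin 6}, RemovableAt (tileUnion S₀) u a m → 24 * δ < dist (triMeshPoint δ u) (triMeshPoint δ (bdryTail (tileUnion S₀) b n₁)) →
      24 * δ < dist (triMeshPoint δ u) (triMeshPoint δ (bdryTail (tileUnion S₀) b (n₁ + k₃))) → ∀ s : Fin 6, s.val < m.val →
      segment ℝ (meshCenter δ (leftFaceDir u (a + s))) (meshCenter δ (leftFaceDir u (a + s + 5))) ⊆ S := by
    intro u a m hR hv1 hv3 s hs z hz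
    have hout : u + triDir (a + s) ∉ (tileUnion S₀) := (hR.out_iff s).2 hs
    have hnear := dist_le_of_mem_fanSeg hδ u (a + s) hz
    have hoff := near_off hv1 hv3 z (by linarith)
    exact hJ_off z (hκ_off z fun n hz1 => tailStep_not_mem_fanSeg hD hδ0 hout n hz1 hz) hoff.1
      (hα_off z (hGU u hR.mem (mem_closedBall.2 (by linarith)))) hoff.2
  have hfanConn : ∀ {u : Site 2} {a m : Fin 6}, RemovableAt (tileUnion S₀) u a m → 24 * δ < dist (triMeshPoint δ u) (triMeshPoint δ (bdryTail (tileUnion S₀) b n₁)) →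
      24 * δ < dist (triMeshPoint δ u) (triMeshPoint δ (bdryTail (tileUnion S₀) b (n₁ + k₃))) → ∀ s s' : ℕ, s ≤ s' → s' < m.val →
      (meshCenter δ (leftFaceDir u (a + Fin.ofNat 6 s)) ∈ connectedComponentIn S ℓ ↔
        meshCenter δ (leftFaceDir u (a + Fin.ofNat 6 s')) ∈ connectedComponentIn S ℓ) := by
    intro u a m hR hv1 hv3 s s' hss' hs'
    induction s', hss' using Nat.le_induction with
    | base => exact Iff.rfl
    | succ s' hss' ih =>
      rw [ih (by omega)]
      have hval : (Fin.ofNat 6 (s' + 1)).val < m.val := by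
        rw [Fin.val_ofNat, Nat.mod_eq_of_lt (by have := hR.le_five; omega)]; exact hs'
      have hseg := hfan hR hv1 hv3 (Fin.ofNat 6 (s' + 1)) hval
      rw [add_ofNat_succ_add_five] at hseg
      exact ⟨fun h => join (convex_segment _ _).isPreconnected hseg (right_mem_segment _ _ _) (left_mem_segment _ _ _) h,
        fun h => join (convex_segment _ _).isPreconnected hseg (left_mem_segment _ _ _) (right_mem_segment _ _ _) h⟩
  -- (iii) tethers at far positions, after their anchor, lie off `J`
  have htether : ∀ n, 24 * δ < dist (triMeshPoint δ (bdryTail (tileUnion S₀) b n)) (triMeshPoint δ (bdryTail (tileUnion S₀) b n₁)) →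
      24 * δ < dist (triMeshPoint δ (bdryTail (tileUnion S₀) b n)) (triMeshPoint δ (bdryTail (tileUnion S₀) b (n₁ + k₃))) → (τ n).tip ∉ A →
      ∃ C : Set ℂ, IsPreconnected C ∧ C ⊆ S ∧ (τ n).path (τ n).anchor ∈ C ∧ (τ n).tip ∈ C := by
    intro n hv1 hv3 htipA
    refine ⟨(fun x : ℝ => (τ n).path.extend x) '' Icc ((τ n).anchor : ℝ) 1,
      isPreconnected_Icc.image _ (τ n).path.continuous_extend.continuousOn, ?_,
      ⟨(τ n).anchor, ⟨le_rfl, (τ n).anchor.2.2⟩, Path.extend_extends' _ _⟩,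
      ⟨1, ⟨(τ n).anchor.2.2, le_rfl⟩, Path.extend_one _⟩⟩
    rintro z ⟨x, hx, rfl⟩
    have hx01 : x ∈ Icc (0 : ℝ) 1 := ⟨(τ n).anchor.2.1.trans hx.1, hx.2⟩
    show (τ n).path.extend x ∈ S
    rw [Path.extend_apply _ hx01]
    set s : unitInterval := ⟨x, hx01⟩
    have hle : (τ n).anchor ≤ s := hx.1
    have hoff := near_off hv1 hv3 ((τ n).path s) ((τ n).dist_le s)
    refine hJ_off _ (hκ_off _ fun n' => ((τ n).avoids s hle).not_mem_tailStep hD n') hoff.1 ?_ hoff.2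
    rcases eq_or_lt_of_le hx.2 with hx1 | hx1
    · have : (τ n).path s = (τ n).tip := by
        rw [show s = 1 from Subtype.ext hx1]; exact (τ n).path.target
      rw [this]
      rintro ⟨s', hs'⟩
      exact htipA (hαA (hs' ▸ hα_range s'))
    · exact hα_off _ ((τ n).mem_of_lt_one s hx1)
  -- (iv) the complementary arc `E = ∂D ∖ α` lies off `J`
  set E := D.boundary '' Ioo (max σ₁ σ₃) (min σ₁ σ₃ + 1) with hE
  have hE_S : E ⊆ S := by
    intro z hzE
    have hzfr : z ∈ frontier D.carrier := by obtain ⟨x, -, rfl⟩ := hzE; exact D.boundary_mem_frontier x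
    have hzU := hnotU_of_frontier z hzfr
    have hzα : z ∉ α := fun h => boundary_image_Ioo_disjoint D hzE h
    have hτE : ∀ n, (τ n).tip ∈ α → z ∉ range (τ n).path := by
      rintro n htipα ⟨s, rfl⟩
      rcases eq_or_lt_of_le s.2.2 with hs1 | hs1
      · have : (τ n).path s = (τ n).tip := by
          rw [show s = 1 from Subtype.ext hs1]; exact (τ n).path.target
        apply hzα; rw [this]; exact htipα
      · exact hzU ((τ n).mem_of_lt_one s hs1)
    refine hJ_off z (hκ_off z fun n hz1 => hzU (hκU n z hz1)) (hτE _ hq₃α) ?_ (hτE _ hq₁α)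
    rintro ⟨s, rfl⟩
    exact hzα (hα_range s)
  have hE_conn : IsPreconnected E := isPreconnected_Ioo.image _ D.continuous_boundary.continuousOn
  have htipE : ∀ n, (τ n).tip ∉ A → (τ n).tip ∈ E := fun n h =>
    boundary_mem_image_Ioo_of_not_mem D (τ n).tip_mem fun h' => h (hαA h')
  have htip2A : (τ (n₁ + k₂)).tip ∉ A := fun h => by have := hfar2 _ h; rw [dist_self] at this; linarith
  have htip4A : (τ (n₁ + k₄)).tip ∉ A := fun h => by have := hfar4 _ h; rw [dist_self] at this; linarith
  ---------------------------------------------------------------------------------------------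
  -- the chain: `ℓ ~ c(Fe₄) ~ c(F₄') ~ (fan at (bdryTail (tileUnion S₀) b (n₁ + k₄))) ~ m₄ ~ tip₄ ~ tip₂ ~ m₂ ~ (fan at (bdryTail (tileUnion S₀) b (n₁ + k₂))) ~ r`
  ---------------------------------------------------------------------------------------------
  -- the run of `(bdryTail (tileUnion S₀) b (n₁ + k₄))` and its exit edge
  obtain ⟨a₄, m₄, hR₄, hm₄⟩ := hremt (n₁ + k₄)
  obtain ⟨d₄, hd₄, hrun₄, hexit₄⟩ := run_window hD hR₄ (rfl : bdryTail (tileUnion S₀) b (n₁ + k₄) = (bdryTail (tileUnion S₀) b (n₁ + k₄)))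
  set K₄ := a₄ + m₄ with hK₄
  set g₄ := (bdryTail (tileUnion S₀) b (n₁ + k₄)) + triDir K₄ with hg₄
  have hg₄ne : (bdryTail (tileUnion S₀) b (n₁ + k₄)) ≠ g₄ := fun h => triDir_ne_zero K₄ (by rw [hg₄] at h; exact (add_eq_left.1 h.symm))
  set Fe₄ := leftFaceDir (bdryTail (tileUnion S₀) b (n₁ + k₄)) K₄ with hFe₄
  have hg₄G : g₄ ∈ (tileUnion S₀) := hR₄.inside le_rfl
  have hFe₄G : hexFaceVertices Fe₄ ⊆ (tileUnion S₀) := by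
    rw [hFe₄, hexFaceVertices_leftFaceDir]
    intro x hx
    simp only [Finset.mem_insert, Finset.mem_singleton] at hx
    rcases hx with rfl | rfl | rfl
    · exact hu₄G
    · exact hg₄G
    · rw [hK₄, add_assoc]
      refine hR₄.inside ?_
      rw [Fin6.val_add_of_lt (by simp; omega)]; simp
  -- `c(Fe₄)` is joined to `ℓ` through the faces of `(tileUnion S₀)`
  have step1 : meshCenter δ Fe₄ ∈ connectedComponentIn S ℓ :=
    hGface Fe₄ (pathIn_triFacesIn_tileUnion hconn (mem_triFacesIn.2 hFeG) (mem_triFacesIn.2 hFe₄G))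
  -- the exit edge of `(bdryTail (tileUnion S₀) b (n₁ + k₄))` is no piece of `κ`
  have hexit₄_notκ : ∀ i < k₃, bdryTail (tileUnion S₀) b (n₁ + i) ≠ bdryTail (tileUnion S₀) b (n₁ + i + 1) →
      s(bdryTail (tileUnion S₀) b (n₁ + i), bdryTail (tileUnion S₀) b (n₁ + i + 1)) = s((bdryTail (tileUnion S₀) b (n₁ + k₄)), g₄) → False := by
    intro i hi hne hpair
    have hne₄ : bdryTail (tileUnion S₀) b (n₁ + k₄ + d₄) ≠ bdryTail (tileUnion S₀) b (n₁ + k₄ + d₄ + 1) := by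
      rw [hrun₄ d₄ le_rfl, hexit₄]; exact hg₄ne
    have hpair' : s(bdryTail (tileUnion S₀) b (n₁ + i), bdryTail (tileUnion S₀) b (n₁ + i + 1)) =
        s(bdryTail (tileUnion S₀) b (n₁ + k₄ + d₄), bdryTail (tileUnion S₀) b (n₁ + k₄ + d₄ + 1)) := by rw [hpair, hrun₄ d₄ le_rfl, hexit₄]
    have hmod := tailStep_pair_eq hD hrem hne hne₄ hpair'
    rw [add_assoc] at hmod
    have hmod' : i % N = (k₄ + d₄) % N := Nat.ModEq.add_left_cancel' n₁ hmod
    by_cases hlt : k₄ + d₄ < N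
    · rw [Nat.mod_eq_of_lt (by omega), Nat.mod_eq_of_lt hlt] at hmod'
      omega
    · have e : bdryTail (tileUnion S₀) b (n₁ + k₄ + (N - k₄)) = (bdryTail (tileUnion S₀) b (n₁ + k₄)) := hrun₄ (N - k₄) (by omega)
      rw [show n₁ + k₄ + (N - k₄) = n₁ + N by omega, bdryTail_add_card hD] at e
      exact hne41 e.symm
  have step2 : meshCenter δ (leftFaceDir (bdryTail (tileUnion S₀) b (n₁ + k₄)) (K₄ + 5)) ∈ connectedComponentIn S ℓ := by
    have hseg : segment ℝ (meshCenter δ Fe₄) (meshCenter δ (leftFaceDir (bdryTail (tileUnion S₀) b (n₁ + k₄)) (K₄ + 5))) ⊆ S := by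
      intro z hz
      have hnear : dist z (triMeshPoint δ (bdryTail (tileUnion S₀) b (n₁ + k₄))) ≤ δ := dist_le_of_mem_fanSeg hδ (bdryTail (tileUnion S₀) b (n₁ + k₄)) K₄ hz
      have hoff := near_off d41 d43 z (by linarith)
      refine hJ_off z (hκ_off' z ?_ ?_) hoff.1 (hα_off z (hGU (bdryTail (tileUnion S₀) b (n₁ + k₄)) hu₄G (mem_closedBall.2 (by linarith)))) hoff.2
      · intro h; rw [h, dist_comm] at hnear; linarith
      · intro i hi hz1
        rw [hFe₄, ← oppFace_leftFaceDir_jExit] at hz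
        have hab := (bdryTail_succ_eq_or_adj hD (n₁ + i)).imp Eq.symm id
        rcases eq_side_of_mem_segment_mesh hδ0 hab hz1 hz with ⟨h1, h2⟩ | ⟨h1, h2⟩ <;>
          rw [faceVertex_leftFaceDir_jExit_succ] at * <;> rw [faceVertex_leftFaceDir_jExit_succ_succ] at *
        · exact hexit₄_notκ i hi (by rw [h1, h2]; exact hg₄ne) (by rw [h1, h2])
        · exact hexit₄_notκ i hi (by rw [h1, h2]; exact hg₄ne.symm) (by rw [h1, h2, Sym2.eq_swap])
    exact join (convex_segment _ _).isPreconnected hseg (left_mem_segment _ _ _) (right_mem_segment _ _ _) step1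
  -- around `(bdryTail (tileUnion S₀) b (n₁ + k₄))` to the face on the dart edge `{(bdryTail (tileUnion S₀) b (n₁ + k₄)), w₄}` and to its midpoint `m₄`
  obtain ⟨κ₄, hw₄, hw₄G⟩ := hhead (n₁ + k₄)
  obtain ⟨t₄, rfl⟩ := exists_offset a₄ κ₄
  have ht₄ : t₄.val < m₄.val := (hR₄.out_iff t₄).1 hw₄G
  have step3 : meshCenter δ (leftFaceDir (bdryTail (tileUnion S₀) b (n₁ + k₄)) (a₄ + t₄)) ∈ connectedComponentIn S ℓ := by
    have e0 : K₄ + 5 = a₄ + Fin.ofNat 6 (m₄.val - 1) := add_add_five_eq a₄ m₄ hR₄.one_le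
    rw [e0] at step2
    have := (hfanConn hR₄ d41 d43 t₄.val (m₄.val - 1) (by omega) (by omega)).2 step2
    rwa [fin6_ofNat_val] at this
  have step4 : (τ (n₁ + k₄)).path (τ (n₁ + k₄)).anchor ∈ connectedComponentIn S ℓ := by
    rw [(τ (n₁ + k₄)).anchor_eq, hw₄]
    exact join (convex_segment _ _).isPreconnected (hfan hR₄ d41 d43 t₄ ht₄) (left_mem_segment _ _ _)
      (midpoint_mem_fanSeg δ (bdryTail (tileUnion S₀) b (n₁ + k₄)) (a₄ + t₄)) step3
  -- along the tether at `n₁ + k₄` to its tip, along `E` to the tip at `n₁ + k₂`, back along that tether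
  have step5 : (τ (n₁ + k₄)).tip ∈ connectedComponentIn S ℓ := by
    obtain ⟨C, hC, hCS, hm, ht⟩ := htether (n₁ + k₄) d41 d43 htip4A
    exact join hC hCS hm ht step4
  have step6 : (τ (n₁ + k₂)).tip ∈ connectedComponentIn S ℓ :=
    join hE_conn hE_S (htipE _ htip4A) (htipE _ htip2A) step5
  have step7 : (τ (n₁ + k₂)).path (τ (n₁ + k₂)).anchor ∈ connectedComponentIn S ℓ := by
    obtain ⟨C, hC, hCS, hm, ht⟩ := htether (n₁ + k₂) d21 d23 htip2A
    exact join hC hCS ht hm step6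
  -- around `(bdryTail (tileUnion S₀) b (n₁ + k₂))` from the dart edge `{(bdryTail (tileUnion S₀) b (n₁ + k₂)), w₂}` to `F' = leftFaceDir (bdryTail (tileUnion S₀) b (n₁ + k₂)) (K₂ + 5)`, whose centre is `r`
  obtain ⟨κ₂, hw₂, hw₂G⟩ := hhead (n₁ + k₂)
  obtain ⟨t₂, rfl⟩ := exists_offset a₂ κ₂
  have ht₂ : t₂.val < m₂.val := (hR₂.out_iff t₂).1 hw₂G
  have step8 : meshCenter δ (leftFaceDir (bdryTail (tileUnion S₀) b (n₁ + k₂)) (a₂ + t₂)) ∈ connectedComponentIn S ℓ := by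
    rw [(τ (n₁ + k₂)).anchor_eq, hw₂] at step7
    exact join (convex_segment _ _).isPreconnected (hfan hR₂ d21 d23 t₂ ht₂) (midpoint_mem_fanSeg δ (bdryTail (tileUnion S₀) b (n₁ + k₂)) (a₂ + t₂))
      (left_mem_segment _ _ _) step7
  have step9 : r ∈ connectedComponentIn S ℓ := by
    rw [hr, hFopp, add_add_five_eq a₂ m₂ hR₂.one_le]
    have := (hfanConn hR₂ d21 d23 t₂.val (m₂.val - 1) (by omega) (by omega)).1 (by rwa [fin6_ofNat_val])
    exact this
  ---------------------------------------------------------------------------------------------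
  -- conclusion: equal winding numbers, contradiction
  ---------------------------------------------------------------------------------------------
  refine hwind_ne (wind_sub_eq_of_mem_connectedComponentIn (K := range J) J.continuous_extend.continuousOn
    (by rw [J.extend_zero, J.extend_one]) (isCompact_range J.continuous).isClosed (fun s hs => ?_) step9)
  rw [Path.extend_apply _ hs]; exact mem_range_self _

end Literature.Probability.Percolation
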